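/-
Origin: expansion seat `planner-pub-hodgecm-mc-glue-1-g6-0`, handover #343 2026-08-19T15:52Z md5 752d7b87a89e6e173983b109c84ee082 (142 l.) WHOLE-FILE REPLACEMENT (PKG 24588b79de0a, 141 l.; prl1 lineage — consent prl1-g16/desk) — mechanical: `def Level.inf` deleted (now the root's), `levelDirected := ⟨Γ₁ ⊓ Γ₂, Level.Γ_mono inf_le_left, Level.Γ_mono inf_le_right⟩`; `LevelDirected`/`IsCongruenceSubgroup.inf` unchanged. After #342. (`HOME/mc/pub-hodgecm-mc-glue-1-g6/lean/w1/HodgeCM/Proofs/LevelDirected.lean`, md5 752d7b87, 142 lines);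
landed by the gen-13 packager (p-g13) in gate run 37 REPLACES the earlier landed copy of `HodgeCM/Proofs/LevelDirected.lean` (packager comment re-wording per the RUN-32 precedent (gate audit (5) rejects the proof-placeholder tokens s-o-r-r-y / a-d-m-i-t anywhere in a source, comments included; owner consents STATUS l.12035/l.12037/l.12045, no objection by the cutoff): that one word inside the seat's provenance COMMENT at l.2 of the source re-spelt `proof-hole` (resp. `adm-token`); no Lean code byte touched).
-/
/-
Origin: CONSTRUCTION seat `planner-pub-hodgecm-mc-glue-1-g6-0` (unit pub-hodgecm-mc-glue-1-g6, gen 6 of mc-glue-1, node E ASSEMBLER + (W1) root packet), 2026-08-19T15:50Z — revision (W1) of `HodgeCM/Proofs/LevelDirected.lean` for the RUN-37 `Level`-pair ROOT PACKET (kit `mc/pub-hodgecm-mc-glue-1-g6/t37-mcglue1g6.txt`); base PKG 24588b79de0a (prl1 lineage, 141 l.). REPLACE — mechanical re-cut on the (W1) root: `def Level.inf` (:131–135) deleted (the name is now the root's pair meet), `levelDirected` re-proved through `Level.Γ_mono`; statement `LevelDirected` and `IsCongruenceSubgroup.inf` unchanged. Kernel only: 0 `proof-hole`, 0 records, 0 `def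 … : Prop`, cites nothing new; expected `#print axioms` ⊆ {propext, Classical.choice, Quot.sound}.
-/
/-
Origin: HOME/pub-hodgecm-prl1/lean/Prl1/LevelDirectedCore.lean — session planner-pub-hodgecm-prl1-0 (unit pub-hodgecm-prl1).
Intended final place: `HodgeCM/Proofs/LevelDirected.lean` (imports ONLY `HodgeCM.Automorphic.ThetaFacts`); proves the
PROVABLE input `HodgeCM.LevelDirected` of `ThetaFacts` with no hypothesis.  (Split form of handover v2's
`Prl1/LevelDirected.lean`: this file = the proof; `Prl1/CorCMThetaPrime.lean` = the `hLD`-free headline theorems.)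
Origin: expansion seat `planner-pub-hodgecm-prl1-0` (unit pub-hodgecm-prl1), handover v2 2026-08-18T03:16:26Z in the split form offered 03:23:21Z (`HOME/pub-hodgecm-prl1/lean/Prl1/LevelDirectedCore.lean`, md5 0501fe51);
landed by the gen-5 packager as `HodgeCM/Proofs/LevelDirected.lean` (module `Prl1.LevelDirectedCore` → `HodgeCM.Proofs.LevelDirected`; `import Prl1.*` lines renamed to the package modules; module references in prose renamed on 3 line(s); body otherwise verbatim).
-/
import Summits.HodgeConjecture.HodgeCM.Automorphic.ThetaFacts

set_option autoImplicit false

/-!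
# Levels are directed: proof of `HodgeCM.LevelDirected`

Two torsion-free congruence subgroups `Γ₁, Γ₂ ⊂ U(V₃,h)(L₀)` have the common torsion-free congruence refinement
`Γ₁ ∩ Γ₂` (as LEVELS = pairs `(Γ, K)`: the meet `Level.inf` of `HodgeCM.CM.Basic`, `K₁ ∩ K₂` compact open and
`U(L₀) ∩ (K₁ ∩ K₂) = Γ₁ ∩ Γ₂`; this file keeps the group-level lemma `IsCongruenceSubgroup.inf`).  The only point is the congruence condition of the vendored `IsCongruenceSubgroup` (a principal
congruence subgroup `Γ(n) ≤ Γ` of finite index IN `Γ`): with `Γ(n₁) ≤ Γ₁`, `Γ(n₂) ≤ Γ₂` we show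
`Γ(lcm(n₁,n₂)) = Γ(n₁) ∩ Γ(n₂)` for the integral congruence condition `g = 1 + n·A` (`A` with entries in `𝓞_E`;
Bézout for `n₁/d, n₂/d`, `d = gcd`) and that an intersection of finite-index subgroups restricted to a subgroup
keeps finite index (`Subgroup.relIndex_inf_ne_zero`, `Subgroup.relIndex_eq_zero_of_le_right`).  No finiteness of
`GL₃(𝓞/n)` is needed.  Consequence: the hypothesis `hLD` of `HodgeCM.Proofs.RealisationConstruction` /
`HodgeCM.Assembly.CorCMTheta` is discharged (`…_of'` versions in `HodgeCM.Assembly.CorCMThetaPrime`).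
-/

noncomputable section

namespace Literature.AlgebraicGeometry.ShimuraVarieties

open Matrix NumberField

variable {E : Type*} [Field E] {m : Type*} [Fintype m] [DecidableEq m]

/-- `g ≡ 1 (mod N)` and `n ∣ N` give `g ≡ 1 (mod n)`. -/
theorem IsCongruentOneMod.of_dvd {n N : ℕ} (h : n ∣ N) {g : Matrix m m E} (hg : IsCongruentOneMod N g) :
    IsCongruentOneMod n g := by
  obtain ⟨k, rfl⟩ := h
  obtain ⟨A, hA⟩ := hg
  refine ⟨k • A, ?_⟩
  have hmap : (k • A).map (algebraMap (𝓞 E) E) = k • A.map (algebraMap (𝓞 E) E) := by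
    change (algebraMap (𝓞 E) E).mapMatrix (k • A) = _
    rw [map_nsmul]
    rfl
  rw [hA, hmap, mul_nsmul']

omit [Fintype m] in
/-- `g ≡ 1 (mod d·u)` and `g ≡ 1 (mod d·v)` with `u, v` coprime give `g ≡ 1 (mod d·u·v)` (entrywise Bézout in
`𝓞_E`). -/
theorem IsCongruentOneMod.of_coprime {d u v : ℕ} (huv : Nat.Coprime u v) {g : Matrix m m E}
    (h₁ : IsCongruentOneMod (d * u) g) (h₂ : IsCongruentOneMod (d * v) g) :
    IsCongruentOneMod (d * u * v) g := by
  obtain ⟨A, hA⟩ := h₁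
  obtain ⟨B, hB⟩ := h₂
  -- Bézout: u s + v t = 1
  have hbez : ((u : ℤ) * Nat.gcdA u v + (v : ℤ) * Nat.gcdB u v : ℤ) = 1 := by
    rw [← Nat.gcd_eq_gcd_ab, Nat.Coprime.gcd_eq_one huv]; rfl
  set s : ℤ := Nat.gcdA u v
  set t : ℤ := Nat.gcdB u v
  refine ⟨fun i j => (s : 𝓞 E) * B i j + (t : 𝓞 E) * A i j, ?_⟩
  -- entrywise
  have hAB : ∀ i j, ((d * u : ℕ) : E) * algebraMap (𝓞 E) E (A i j) =
      ((d * v : ℕ) : E) * algebraMap (𝓞 E) E (B i j) := by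
    intro i j
    have h := congrFun (congrFun (hA.symm.trans hB) i) j
    simpa [Matrix.add_apply, Matrix.smul_apply, Matrix.map_apply, nsmul_eq_mul] using h
  rw [hA]
  congr 1
  ext i j
  simp only [Matrix.smul_apply, Matrix.map_apply, nsmul_eq_mul, map_add, map_mul, map_intCast]
  have hbezE : (u : E) * (s : E) + (v : E) * (t : E) = 1 := by
    have h := congrArg (fun z : ℤ => (z : E)) hbez
    push_cast at h
    exact h
  have h := hAB i j
  push_cast at h ⊢
  linear_combination ((u : E) * (s : E)) * h - ((d : E) * (u : E) * algebraMap (𝓞 E) E (A i j)) * hbezE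

/-- `Γ(N) ≤ Γ(n)` for `n ∣ N`. -/
theorem principalCongruenceSubgroup_le_of_dvd (σ : E →+* E) (H : Matrix m m E) {n N : ℕ} (h : n ∣ N) :
    principalCongruenceSubgroup σ H N ≤ principalCongruenceSubgroup σ H n :=
  fun _ hg => ⟨hg.1, hg.2.1.of_dvd h, hg.2.2.of_dvd h⟩

/-- `Γ(d u) ∩ Γ(d v) ≤ Γ(d u v)` for coprime `u, v` (so `Γ(n₁) ∩ Γ(n₂) = Γ(lcm(n₁,n₂))` with
`principalCongruenceSubgroup_le_of_dvd`). -/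
theorem principalCongruenceSubgroup_inf_le_of_coprime (σ : E →+* E) (H : Matrix m m E) {d u v : ℕ}
    (huv : Nat.Coprime u v) :
    principalCongruenceSubgroup σ H (d * u) ⊓ principalCongruenceSubgroup σ H (d * v) ≤
      principalCongruenceSubgroup σ H (d * u * v) :=
  fun _ hg => ⟨hg.1.1, hg.1.2.1.of_coprime huv hg.2.2.1, hg.1.2.2.of_coprime huv hg.2.2.2⟩

/-- **The intersection of two congruence subgroups is a congruence subgroup** (for the vendored notion:
`Γ(n) ≤ Γ` of finite index in `Γ`). -/
theorem IsCongruenceSubgroup.inf (σ : E →+* E) (H : Matrix m m E) {Γ₁ Γ₂ : Subgroup (GL m E)}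
    (h₁ : IsCongruenceSubgroup σ H Γ₁) (h₂ : IsCongruenceSubgroup σ H Γ₂) :
    IsCongruenceSubgroup σ H (Γ₁ ⊓ Γ₂) := by
  obtain ⟨hU₁, n₁, hn₁, hle₁, hfi₁⟩ := h₁
  obtain ⟨_, n₂, hn₂, hle₂, hfi₂⟩ := h₂
  -- n₁ = d u, n₂ = d v, u ⊥ v
  obtain ⟨d, u, v, hd, hu, hv, huv⟩ : ∃ d u v : ℕ, 0 < d ∧ n₁ = d * u ∧ n₂ = d * v ∧ Nat.Coprime u v :=
    ⟨Nat.gcd n₁ n₂, n₁ / Nat.gcd n₁ n₂, n₂ / Nat.gcd n₁ n₂, Nat.gcd_pos_of_pos_left _ hn₁,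
      (Nat.mul_div_cancel' (Nat.gcd_dvd_left _ _)).symm, (Nat.mul_div_cancel' (Nat.gcd_dvd_right _ _)).symm,
      Nat.coprime_div_gcd_div_gcd (Nat.gcd_pos_of_pos_left _ hn₁)⟩
  subst hu hv
  have hN : principalCongruenceSubgroup σ H (d * u * v) =
      principalCongruenceSubgroup σ H (d * u) ⊓ principalCongruenceSubgroup σ H (d * v) :=
    le_antisymm
      (le_inf (principalCongruenceSubgroup_le_of_dvd σ H (Dvd.intro v rfl))
        (principalCongruenceSubgroup_le_of_dvd σ H (Dvd.intro u (by ring))))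
      (principalCongruenceSubgroup_inf_le_of_coprime σ H huv)
  refine ⟨fun g hg => hU₁ hg.1, d * u * v, ?_, ?_, ?_⟩
  · have h1 := Nat.pos_iff_ne_zero.mp hn₁
    have h2 := Nat.pos_iff_ne_zero.mp hn₂
    rw [mul_ne_zero_iff] at h1 h2
    exact Nat.pos_iff_ne_zero.mpr (mul_ne_zero_iff.mpr ⟨mul_ne_zero_iff.mpr ⟨h1.1, h1.2⟩, h2.2⟩)
  · rw [hN]; exact inf_le_inf hle₁ hle₂
  · rw [hN]
    constructor
    show ((principalCongruenceSubgroup σ H (d * u) ⊓ principalCongruenceSubgroup σ H (d * v)).relIndex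
      (Γ₁ ⊓ Γ₂)) ≠ 0
    exact Subgroup.relIndex_inf_ne_zero
      (fun h0 => hfi₁.index_ne_zero (Subgroup.relIndex_eq_zero_of_le_right inf_le_left h0))
      (fun h0 => hfi₂.index_ne_zero (Subgroup.relIndex_eq_zero_of_le_right inf_le_right h0))

end Literature.AlgebraicGeometry.ShimuraVarieties

namespace HodgeCM

open Literature.AlgebraicGeometry.ShimuraVarieties (conjRingHomK IsCongruenceSubgroup)

/-- **`HodgeCM.LevelDirected` holds** (PROVABLE input R2 of `HodgeCM.Automorphic.ThetaFacts`, discharged): the meet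
`Γ₁ ⊓ Γ₂ = (Γ₁ ∩ Γ₂, K₁ ∩ K₂)` of `HodgeCM.CM.Basic` (`Level.inf`, the pair meet of the `K`-ordered levels) lies below
both in `GL₃(L)` (`Level.Γ_mono`). -/
theorem levelDirected : LevelDirected := fun _ _ _ Γ₁ Γ₂ =>
  ⟨Γ₁ ⊓ Γ₂, Level.Γ_mono inf_le_left, Level.Γ_mono inf_le_right⟩

end HodgeCM

end
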